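import Mathlib.Data.Nat.Choose.Central
import Literature.Barriers.PneNP.MonotoneGapProofs
import Literature.Computability.Complexity.PerfectMatchingLowerBound
import HarnessLib

/-!
# The monotone gap: discharge of `Razborov1985b_perfectMatching` (Jukna 2012, Thm. 9.38)

`MonotoneGap.lean` vendors Razborov's theorem on the logical permanent as the named fact
`Literature.Barriers.PneNP.Razborov1985b_perfectMatching`: for some `c > 0` and all large `m`,
`m ^ (c log m) ≤ circuitSizeOver monotoneBasis (perfectMatchingFn m)`. This file PROVES it
(`Razborov1985b_perfectMatching_holds`, with `c = 1/100` and natural logarithms), completing the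
approximation-method development of
`Literature/Computability/Complexity/PerfectMatching{Approximators,Colorings,LowerBound}.lean`
(Jukna 2012, §9.10–9.11) by the two remaining ingredients of Jukna's proof of Thm. 9.38:

* **Lemma 9.33** in counting form (`card_filter_perfectMatchingFn_colorInput_sq_mul_le`):
  the colourings `h` whose graph `E₋(h)` has a perfect matching are balanced
  (`#{u : h(u)=1} = #{v : h(v)=1}` on the two sides), hence number `N` with
  `N² (m+1) ≤ 16^m`, i.e. `Prob[f_m(E₋) = 1] ≤ 1/√(m+1)` (Jukna: `≤ 2/√m`), via the elementary
  central-binomial estimate `(m+1) · C(m, ⌊m/2⌋)² ≤ 4^m` (`succ_mul_choose_middle_sq_le`);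
* the **choice of parameters** and the final count (`pm_case1_bound`, `pm_case2_bound`): with
  `L = ln m`, `s = ⌊L/10⌋`, `q = ⌈e^{L/8}⌉`, `r = (s q)²` (Jukna takes `s = ⌊(log₂ m)/8⌋`,
  `r = ⌊m^{1/4} (log₂ m)^8⌋`; only the constant in `Ω` changes), Case 1 of the dichotomy gives
  `t ≥ (m - s)^{s+1} / r^{2s} ≥ e^{s(L/4 - 1)}` and Case 2 gives
  `t ≥ ½ e^{-L/10} · e^{q 2^{-s}} / (m² + 1)^s`, both `≥ e^{L²/100} = m^{log m/100}` for
  `L ≥ 4000`;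
* `exists_monotone_circuit_perfectMatchingFn` — `f_m` (`m ≥ 1`) is a non-constant monotone
  function, so `circuitSizeOver monotoneBasis (perfectMatchingFn m)` is attained, not junk.

## References

* S. Jukna, *Boolean Function Complexity: Advances and Frontiers*, Springer (2012), §9.11,
  Lemma 9.33 and Thm. 9.38 (PDF pp. 292, 295–296) [Jukna2012].
* A. A. Razborov, *Lower bounds on monotone complexity of the logical permanent*, Mat. Zametki
  37 (1985) 887–900 [Razborov1985b].
* É. Tardos, *The gap between monotone and non-monotone circuit complexity is exponential*,
  Combinatorica 8 (1988) 141–142, p. 141 (a) [Tardos1988].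
-/

noncomputable section

namespace Literature.Barriers.PneNP

open Literature.Computability.Complexity Literature.Computability.Complexity.PerfectMatching
open Finset Real Filter

/-! ### The perfect matching function on the test inputs -/

/-- Every perfect matching is accepted by `f_m`. [cite: Jukna2012, §9.11 (PDF p. 292, "Prob[f_m(E₊) = 1] = 1")] -/
theorem perfectMatchingFn_permInput {m : ℕ} (σ : Equiv.Perm (Fin m)) :
    perfectMatchingFn m (permInput σ) = true :=
  (perfectMatchingFn_eq_true_iff m _).2 ⟨σ, fun i => by simp [permInput]⟩

/-- If `E₋(h)` has a perfect matching, the two sides have equally many `1`-coloured vertices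
(Jukna 2012, proof of Lemma 9.33: "`E₋` has a perfect matching iff `Σ_u h(u) = Σ_v h(v)`"; only
this direction is needed). [cite: Jukna2012, Lemma 9.33] -/
theorem card_filter_eq_of_perfectMatchingFn_colorInput {m : ℕ} {h : Vtx m → Bool}
    (hf : perfectMatchingFn m (colorInput h) = true) :
    #(univ.filter fun u : Fin m => h (Sum.inl u) = true) =
      #(univ.filter fun v : Fin m => h (Sum.inr v) = true) := by
  classical
  obtain ⟨σ, hσ⟩ := (perfectMatchingFn_eq_true_iff m _).1 hf
  have hσ' : ∀ i, h (Sum.inl i) = h (Sum.inr (σ i)) := fun i => by simpa [colorInput] using hσ i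
  rw [← card_image_of_injective (univ.filter fun u : Fin m => h (Sum.inl u) = true) σ.injective]
  refine congrArg card (Finset.ext fun v => ?_)
  simp only [mem_image, mem_filter, mem_univ, true_and]
  constructor
  · rintro ⟨u, hu, rfl⟩
    rwa [← hσ' u]
  · intro hv
    refine ⟨σ.symm v, ?_, Equiv.apply_symm_apply σ v⟩
    rw [hσ', Equiv.apply_symm_apply]
    exact hv

/-! ### Lemma 9.33: few colourings are balanced -/

/-- The `0/1`-vectors of length `m` with exactly `j` ones number `C(m, j) ≤ C(m, ⌊m/2⌋)`.
[folklore] -/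
theorem card_filter_card_ones_le {m : ℕ} (j : ℕ) :
    #(univ.filter fun g : Fin m → Bool => #(univ.filter fun u => g u = true) = j) ≤ m.choose (m / 2) := by
  classical
  calc #(univ.filter fun g : Fin m → Bool => #(univ.filter fun u => g u = true) = j)
      ≤ #(powersetCard j (univ : Finset (Fin m))) := by
        refine card_le_card_of_injOn (fun g => univ.filter fun u => g u = true) (fun g hg => ?_)
          (fun g₁ _ g₂ _ heq => ?_)
        · rw [mem_coe, mem_filter] at hg
          exact mem_coe.2 (mem_powersetCard.2 ⟨subset_univ _, hg.2⟩)
        · funext u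
          have h := Finset.ext_iff.1 heq u
          simp only [mem_filter, mem_univ, true_and] at h
          exact Bool.eq_iff_iff.2 h
    _ = m.choose j := by rw [card_powersetCard, card_univ, Fintype.card_fin]
    _ ≤ m.choose (m / 2) := Nat.choose_le_middle j m

/-- **Balanced colourings are few**: the colourings of the `2m` vertices with equally many
`1`-coloured vertices on both sides number at most `2^m · C(m, ⌊m/2⌋)` (fibre over the
colouring of the right side; Jukna 2012, proof of Lemma 9.33:
"`≤ max_j Prob[Σ_v h(v) = j] ≤ C(m, m/2) 2^{-m}`"). [cite: Jukna2012, Lemma 9.33] -/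
theorem card_balanced_le (m : ℕ) :
    #(univ.filter fun h : Vtx m → Bool =>
        #(univ.filter fun u : Fin m => h (Sum.inl u) = true) =
          #(univ.filter fun v : Fin m => h (Sum.inr v) = true)) ≤ 2 ^ m * m.choose (m / 2) := by
  classical
  set Bal := univ.filter fun h : Vtx m → Bool =>
    #(univ.filter fun u : Fin m => h (Sum.inl u) = true) =
      #(univ.filter fun v : Fin m => h (Sum.inr v) = true) with hBal
  have hfib := card_eq_sum_card_fiberwise (s := Bal) (t := (univ : Finset (Fin m → Bool)))
    (f := fun h => fun v => h (Sum.inr v)) fun _ _ => mem_coe.2 (mem_univ _)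
  rw [hfib]
  calc ∑ g ∈ (univ : Finset (Fin m → Bool)), #(Bal.filter fun h => (fun v => h (Sum.inr v)) = g)
      ≤ ∑ _g ∈ (univ : Finset (Fin m → Bool)), m.choose (m / 2) := by
        refine sum_le_sum fun g _ => ?_
        calc #(Bal.filter fun h => (fun v => h (Sum.inr v)) = g)
            ≤ #(univ.filter fun gL : Fin m → Bool =>
                #(univ.filter fun u => gL u = true) = #(univ.filter fun v => g v = true)) := by
              refine card_le_card_of_injOn (fun h => fun u => h (Sum.inl u)) (fun h hh => ?_)
                (fun h₁ hh₁ h₂ hh₂ heq => ?_)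
              · rw [mem_coe, mem_filter] at hh
                obtain ⟨hB, hg⟩ := hh
                have hb := (mem_filter.1 hB).2
                refine mem_coe.2 (mem_filter.2 ⟨mem_univ _, ?_⟩)
                rw [← hg]
                exact hb
              · rw [mem_coe, mem_filter] at hh₁ hh₂
                funext w
                rcases w with u | v
                · exact congrFun heq u
                · exact (congrFun hh₁.2 v).trans (congrFun hh₂.2 v).symm
          _ ≤ m.choose (m / 2) := card_filter_card_ones_le _
    _ = 2 ^ m * m.choose (m / 2) := by
        rw [sum_const, smul_eq_mul, card_univ, Fintype.card_fun, Fintype.card_bool, Fintype.card_fin]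

/-- **Central binomial estimate**: `(2n+1) · C(2n, n)² ≤ 16ⁿ` (induction with
`(n+1) C(2n+2, n+1) = 2(2n+1) C(2n, n)` and `4(2n+1)(2n+3) ≤ 16(n+1)²`). [folklore] -/
theorem centralBinom_sq_mul_le (n : ℕ) : (2 * n + 1) * n.centralBinom ^ 2 ≤ 16 ^ n := by
  induction n with
  | zero => simp [Nat.centralBinom_zero]
  | succ n ih =>
    have h := Nat.succ_mul_centralBinom_succ n
    have hpos : 0 < (n + 1) ^ 2 := by positivity
    refine Nat.le_of_mul_le_mul_left ?_ hpos
    calc (n + 1) ^ 2 * ((2 * (n + 1) + 1) * (n + 1).centralBinom ^ 2)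
        = (2 * n + 3) * ((n + 1) * (n + 1).centralBinom) ^ 2 := by ring
      _ = (2 * n + 3) * (2 * (2 * n + 1) * n.centralBinom) ^ 2 := by rw [h]
      _ = 4 * (2 * n + 3) * (2 * n + 1) * ((2 * n + 1) * n.centralBinom ^ 2) := by ring
      _ ≤ 4 * (2 * n + 3) * (2 * n + 1) * 16 ^ n := Nat.mul_le_mul_left _ ih
      _ ≤ 16 * (n + 1) ^ 2 * 16 ^ n := Nat.mul_le_mul_right _ (by nlinarith)
      _ = (n + 1) ^ 2 * 16 ^ (n + 1) := by ring

/-- `(m+1) · C(m, ⌊m/2⌋)² ≤ 4^m` for every `m` (even `m = 2n` is the previous lemma; for odd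
`m = 2n+1`, `C(2n+1, n) = C(2n+2, n+1)/2`). The same elementary estimate is proved, for an
unrelated purpose, as `Literature.Barriers.CriticalPhenomena.Edwards2D.succ_mul_choose_half_sq_le`
(`PlanarEdwardsModelDiffusiveProofs.lean`); it is re-proved here rather than imported because
that file's import cone (the planar Edwards model) is disjoint from circuit complexity — both
copies are candidates for a librarian hoist into a shared central-binomial helper. [folklore] -/
theorem succ_mul_choose_middle_sq_le (m : ℕ) : (m + 1) * (m.choose (m / 2)) ^ 2 ≤ 4 ^ m := by
  obtain ⟨n, rfl | rfl⟩ := Nat.even_or_odd' m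
  · -- even
    have h := centralBinom_sq_mul_le n
    rw [Nat.centralBinom_eq_two_mul_choose] at h
    rw [show 2 * n / 2 = n by omega, show (4 : ℕ) ^ (2 * n) = 16 ^ n by rw [pow_mul]; norm_num]
    exact h
  · -- odd
    have h := centralBinom_sq_mul_le (n + 1)
    have hc : (n + 1).centralBinom = 2 * (2 * n + 1).choose n := by
      rw [Nat.centralBinom_eq_two_mul_choose, show 2 * (n + 1) = (2 * n + 1) + 1 by ring,
        Nat.choose_succ_succ, Nat.choose_symm_half]
      ring
    rw [hc] at h
    rw [show (2 * n + 1) / 2 = n by omega,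
      show (4 : ℕ) ^ (2 * n + 1) = 4 * 16 ^ n by rw [pow_succ, pow_mul]; ring]
    have h4 : 0 < 4 := by norm_num
    refine Nat.le_of_mul_le_mul_left ?_ h4
    calc 4 * ((2 * n + 1 + 1) * ((2 * n + 1).choose n) ^ 2)
        ≤ (2 * (n + 1) + 1) * (2 * (2 * n + 1).choose n) ^ 2 := by nlinarith
      _ ≤ 16 ^ (n + 1) := h
      _ = 4 * (4 * 16 ^ n) := by ring

/-- **Jukna 2012, Lemma 9.33, counting form**: the colourings `h` for which `E₋(h)` has a
perfect matching number `N` with `N² (m + 1) ≤ 16^m`, i.e. `Prob[f_m(E₋) = 1] ≤ 1/√(m+1)`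
(printed: `≤ C(m, m/2) 2^{-m} ≤ 2/√m`). [cite: Jukna2012, Lemma 9.33] -/
theorem card_filter_perfectMatchingFn_colorInput_sq_mul_le (m : ℕ) :
    #(univ.filter fun h : Vtx m → Bool => perfectMatchingFn m (colorInput h) = true) ^ 2 * (m + 1) ≤
      16 ^ m := by
  have h1 : #(univ.filter fun h : Vtx m → Bool => perfectMatchingFn m (colorInput h) = true) ≤
      2 ^ m * m.choose (m / 2) :=
    (card_le_card fun h hh => mem_filter.2 ⟨mem_univ _,
      card_filter_eq_of_perfectMatchingFn_colorInput (mem_filter.1 hh).2⟩).trans (card_balanced_le m)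
  calc #(univ.filter fun h : Vtx m → Bool => perfectMatchingFn m (colorInput h) = true) ^ 2 * (m + 1)
      ≤ (2 ^ m * m.choose (m / 2)) ^ 2 * (m + 1) := Nat.mul_le_mul_right _ (Nat.pow_le_pow_left h1 2)
    _ = 4 ^ m * ((m + 1) * (m.choose (m / 2)) ^ 2) := by
        rw [mul_pow, ← pow_mul, show (2 : ℕ) ^ (m * 2) = 4 ^ m by rw [mul_comm, pow_mul]; norm_num]
        ring
    _ ≤ 4 ^ m * 4 ^ m := Nat.mul_le_mul_left _ (succ_mul_choose_middle_sq_le m)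
    _ = 16 ^ m := by rw [← mul_pow]; norm_num

/-! ### `f_m` has monotone circuits -/

/-- For `m ≥ 1` the perfect matching function rejects the empty graph and accepts `K_{m,m}`,
so, being monotone, it is computed by some circuit over `{∧₂, ∨₂}` (`exists_monotone_circuit`:
the OR of ANDs) and `circuitSizeOver monotoneBasis (perfectMatchingFn m)` is attained.
[cite: Jukna2012, §9.11 (PDF p. 291, "f_m = ⋁_σ ⋀_i x_{i,σ(i)}")] -/
theorem exists_monotone_circuit_perfectMatchingFn {m : ℕ} (hm : 1 ≤ m) :
    ∃ C : Circuit (Edge m), C.IsOver monotoneBasis ∧ C.Computes (perfectMatchingFn m) := by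
  classical
  refine exists_monotone_circuit _ (perfectMatchingFn_monotone m) ?_ ?_
  · rw [Bool.eq_false_iff]
    intro h
    obtain ⟨σ, hσ⟩ := (perfectMatchingFn_eq_true_iff m _).1 h
    exact Bool.false_ne_true (hσ ⟨0, hm⟩)
  · exact (perfectMatchingFn_eq_true_iff m _).2 ⟨1, fun _ => rfl⟩

/-! ### The final count: Case 1 (every perfect matching is lost) -/

/-- **Case 1 of the proof of Jukna's Thm. 9.38**, with `L = ln m ≥ 100`, `s = ⌊L/10⌋` and
closure arity `r = ρ²`, `ρ ≤ e^{3L/16}`: the inequality `m! ≤ t · ((r-1)^s)^2 · (m-s-1)!` forces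
`t ≥ e^{L²/100}`, since `m!/(m-s-1)! ≥ (m-s)^{s+1} ≥ (e^L/2)^s` and `(r-1)^{2s} ≤ e^{3sL/4}`
(Jukna: `t ≥ (m/(2 r² s²))^s = m^{Ω(log m)}`). [cite: Jukna2012, Thm. 9.38, Case 1] -/
theorem pm_case1_bound {m s ρ t : ℕ} {L : ℝ} (hL : 100 ≤ L) (hm : (m : ℝ) = exp L)
    (hsL : (s : ℝ) ≤ L / 10) (hLs : L / 10 < s + 1) (hρ : (ρ : ℝ) ≤ exp (3 * L / 16))
    (h : m.factorial ≤ t * (((ρ ^ 2 - 1) ^ s) ^ 2 * (m - (s + 1)).factorial)) :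
    exp (L ^ 2 / 100) ≤ t := by
  have hL0 : 0 ≤ L := by linarith
  have hs0 : (0 : ℝ) ≤ s := Nat.cast_nonneg s
  have heL : L + 1 ≤ exp L := add_one_le_exp L
  -- `s + 1 ≤ m` and `2 s ≤ m`
  have hsm_real : (s : ℝ) + 1 ≤ m := by rw [hm]; linarith
  have hsm : s + 1 ≤ m := by exact_mod_cast hsm_real
  have hsm2 : 2 * (s : ℝ) ≤ m := by rw [hm]; linarith
  -- the integer inequality `(m - s)^{s+1} ≤ t ρ^{4s}`
  have hdesc : (m - (s + 1)).factorial * (m - s) ^ (s + 1) ≤ m.factorial := by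
    have h1 := Nat.factorial_mul_descFactorial hsm
    have h2 := Nat.pow_sub_le_descFactorial m (s + 1)
    rw [show m + 1 - (s + 1) = m - s by omega] at h2
    calc (m - (s + 1)).factorial * (m - s) ^ (s + 1)
        ≤ (m - (s + 1)).factorial * m.descFactorial (s + 1) := Nat.mul_le_mul_left _ h2
      _ = m.factorial := h1
  have hnat : (m - s) ^ (s + 1) ≤ t * ρ ^ (4 * s) := by
    have hfpos : 0 < (m - (s + 1)).factorial := Nat.factorial_pos _
    have h3 : (m - (s + 1)).factorial * (m - s) ^ (s + 1) ≤
        (m - (s + 1)).factorial * (t * ((ρ ^ 2 - 1) ^ s) ^ 2) := by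
      calc (m - (s + 1)).factorial * (m - s) ^ (s + 1) ≤ m.factorial := hdesc
        _ ≤ t * (((ρ ^ 2 - 1) ^ s) ^ 2 * (m - (s + 1)).factorial) := h
        _ = (m - (s + 1)).factorial * (t * ((ρ ^ 2 - 1) ^ s) ^ 2) := by ring
    refine (Nat.le_of_mul_le_mul_left h3 hfpos).trans (Nat.mul_le_mul_left _ ?_)
    calc ((ρ ^ 2 - 1) ^ s) ^ 2 ≤ ((ρ ^ 2) ^ s) ^ 2 :=
          Nat.pow_le_pow_left (Nat.pow_le_pow_left (Nat.sub_le _ _) _) _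
      _ = ρ ^ (4 * s) := by rw [← pow_mul, ← pow_mul]; ring_nf
  -- pass to the reals
  have hR : (((m - s : ℕ) : ℝ)) ^ (s + 1) ≤ t * (ρ : ℝ) ^ (4 * s) := by exact_mod_cast hnat
  have hcast : ((m - s : ℕ) : ℝ) = m - s := by
    rw [Nat.cast_sub (by omega : s ≤ m)]
  rw [hcast] at hR
  have hms : exp L / 2 ≤ (m : ℝ) - s := by rw [hm] at hsm2 ⊢; linarith
  have h2e : (2 : ℝ) ≤ exp L := by linarith
  have h1e : (1 : ℝ) ≤ exp L / 2 := by linarith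
  have hpow : (exp L / 2) ^ s ≤ ((m : ℝ) - s) ^ (s + 1) :=
    calc (exp L / 2) ^ s ≤ (exp L / 2) ^ (s + 1) := pow_le_pow_right₀ h1e (Nat.le_succ s)
      _ ≤ ((m : ℝ) - s) ^ (s + 1) := pow_le_pow_left₀ (by positivity) hms _
  have hρ0 : (0 : ℝ) ≤ ρ := Nat.cast_nonneg ρ
  have hρpow : (ρ : ℝ) ^ (4 * s) ≤ exp (3 * s * L / 4) :=
    calc (ρ : ℝ) ^ (4 * s) ≤ (exp (3 * L / 16)) ^ (4 * s) := pow_le_pow_left₀ hρ0 hρ _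
      _ = exp (3 * s * L / 4) := by rw [← exp_nat_mul]; push_cast; ring_nf
  have h2e1 : (2 : ℝ) ≤ exp 1 := by linarith [add_one_le_exp (1 : ℝ)]
  have hlow : exp (s * (L - 1)) ≤ (exp L / 2) ^ s := by
    have h1 : exp (L - 1) ≤ exp L / 2 := by
      rw [exp_sub]
      exact div_le_div_of_nonneg_left (exp_nonneg L) two_pos h2e1
    calc exp (s * (L - 1)) = (exp (L - 1)) ^ s := by rw [← exp_nat_mul]
      _ ≤ (exp L / 2) ^ s := pow_le_pow_left₀ (exp_nonneg _) h1 s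
  have ht0 : (0 : ℝ) ≤ t := Nat.cast_nonneg t
  have hcomb : exp (s * (L - 1)) ≤ t * exp (3 * s * L / 4) :=
    hlow.trans (hpow.trans (hR.trans (mul_le_mul_of_nonneg_left hρpow ht0)))
  have hkey : exp (s * (L - 1) - 3 * s * L / 4) ≤ t := by
    rw [exp_sub, div_le_iff₀ (exp_pos _)]
    exact hcomb
  refine le_trans (exp_le_exp.2 ?_) hkey
  have hs' : L / 10 - 1 ≤ s := by linarith
  have hL4 : 0 ≤ L / 4 - 1 := by linarith
  nlinarith [mul_le_mul_of_nonneg_right hs' hL4]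

/-! ### The final count: Case 2 (a matching in the output approximator) -/

/-- The negative error in real form: `|Per_s| · ⌊(2ˢ-1)^q 4^m/(2ˢ)^q⌋ ≤ e^{(L/10)(2L+1)} · 4^m ·
e^{-e^{L/40}}` for `s ≤ L/10`, `q ≥ e^{L/8}`, `m = e^L` (using `|Per_s| ≤ (m²+1)^s ≤ e^{s(2L+1)}`,
`(1 - 2^{-s})^q ≤ e^{-q 2^{-s}}` and `q 2^{-s} ≥ e^{L/8} e^{-L/10} = e^{L/40}`).
[cite: Jukna2012, Thm. 9.38, Case 2] -/
theorem pm_negErr_real_le {m s q P D : ℕ} {L : ℝ} (hm : (m : ℝ) = exp L) (hL0 : 0 ≤ L)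
    (hsL : (s : ℝ) ≤ L / 10) (hq : exp (L / 8) ≤ q)
    (hP : P ≤ (m * m + 1) ^ s) (hD : D * (2 ^ s) ^ q ≤ (2 ^ s - 1) ^ q * 4 ^ m) :
    ((P * D : ℕ) : ℝ) ≤ exp (L / 10 * (2 * L + 1)) * ((4 : ℝ) ^ m * exp (-exp (L / 40))) := by
  have hs0 : (0 : ℝ) ≤ s := Nat.cast_nonneg s
  have h2s : (0 : ℝ) < (2 : ℝ) ^ s := by positivity
  have hFpos : (0 : ℝ) < (4 : ℝ) ^ m := by positivity
  have hD' : (D : ℝ) ≤ (4 : ℝ) ^ m * (1 - ((2 : ℝ) ^ s)⁻¹) ^ q := by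
    have hDc : (D : ℝ) * ((2 : ℝ) ^ s) ^ q ≤ ((2 : ℝ) ^ s - 1) ^ q * (4 : ℝ) ^ m := by
      have : ((D * (2 ^ s) ^ q : ℕ) : ℝ) ≤ (((2 ^ s - 1) ^ q * 4 ^ m : ℕ) : ℝ) := Nat.cast_le.2 hD
      push_cast [Nat.cast_sub Nat.one_le_two_pow] at this
      exact this
    have hpq : (0 : ℝ) < ((2 : ℝ) ^ s) ^ q := by positivity
    rw [← le_div_iff₀ hpq] at hDc
    refine hDc.trans (le_of_eq ?_)
    rw [mul_comm, mul_div_assoc, ← div_pow, sub_div, div_self h2s.ne', one_div]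
  have hone : (1 - ((2 : ℝ) ^ s)⁻¹) ^ q ≤ exp (-(q * ((2 : ℝ) ^ s)⁻¹)) := by
    have h01 : 0 ≤ 1 - ((2 : ℝ) ^ s)⁻¹ := by
      rw [sub_nonneg]
      exact inv_le_one_of_one_le₀ (one_le_pow₀ one_le_two)
    calc (1 - ((2 : ℝ) ^ s)⁻¹) ^ q ≤ (exp (-((2 : ℝ) ^ s)⁻¹)) ^ q :=
          pow_le_pow_left₀ h01 (one_sub_le_exp_neg _) q
      _ = exp (-(q * ((2 : ℝ) ^ s)⁻¹)) := by rw [← exp_nat_mul]; ring_nf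
  have h2e1 : (2 : ℝ) ≤ exp 1 := by linarith [add_one_le_exp (1 : ℝ)]
  have h2s_le : (2 : ℝ) ^ s ≤ exp (L / 10) := by
    calc (2 : ℝ) ^ s ≤ (exp 1) ^ s := pow_le_pow_left₀ zero_le_two h2e1 s
      _ = exp s := by rw [← exp_nat_mul, mul_one]
      _ ≤ exp (L / 10) := exp_le_exp.2 hsL
  have hinv_s : exp (-(L / 10)) ≤ ((2 : ℝ) ^ s)⁻¹ := by
    rw [exp_neg]
    exact inv_anti₀ h2s h2s_le
  have hq2s : exp (L / 40) ≤ q * ((2 : ℝ) ^ s)⁻¹ := by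
    calc exp (L / 40) = exp (L / 8) * exp (-(L / 10)) := by rw [← exp_add]; ring_nf
      _ ≤ q * ((2 : ℝ) ^ s)⁻¹ := mul_le_mul hq hinv_s (exp_nonneg _) (Nat.cast_nonneg q)
  have hexp_decay : (1 - ((2 : ℝ) ^ s)⁻¹) ^ q ≤ exp (-exp (L / 40)) :=
    hone.trans (exp_le_exp.2 (neg_le_neg hq2s))
  have hP' : (P : ℝ) ≤ exp (L / 10 * (2 * L + 1)) := by
    have hP1 : (P : ℝ) ≤ ((m : ℝ) * m + 1) ^ s := by exact_mod_cast hP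
    have hmm : (m : ℝ) * m + 1 ≤ exp (2 * L + 1) := by
      have hLL : (m : ℝ) * m = exp (L + L) := by rw [hm, ← exp_add]
      rw [hLL, show (2 : ℝ) * L + 1 = (L + L) + 1 by ring, exp_add (L + L) 1]
      have h1e : (1 : ℝ) ≤ exp (L + L) := one_le_exp (by linarith)
      nlinarith [h2e1, exp_pos (L + L)]
    calc (P : ℝ) ≤ ((m : ℝ) * m + 1) ^ s := hP1
      _ ≤ (exp (2 * L + 1)) ^ s := pow_le_pow_left₀ (by positivity) hmm s
      _ = exp (s * (2 * L + 1)) := by rw [← exp_nat_mul]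
      _ ≤ exp (L / 10 * (2 * L + 1)) := by
          refine exp_le_exp.2 (mul_le_mul_of_nonneg_right hsL (by linarith))
  push_cast
  exact mul_le_mul hP' (hD'.trans (mul_le_mul_of_nonneg_left hexp_decay hFpos.le))
    (Nat.cast_nonneg D) (exp_nonneg _)

/-- Lemma 9.33 in real form: `N_T² (m+1) ≤ 16^m` gives `N_T ≤ 4^m e^{-L/2}` for `m = e^L`.
[cite: Jukna2012, Lemma 9.33] -/
theorem pm_card_true_real_le {m NT : ℕ} {L : ℝ} (hm : (m : ℝ) = exp L)
    (hT : NT ^ 2 * (m + 1) ≤ 16 ^ m) : (NT : ℝ) ≤ (4 : ℝ) ^ m * exp (-(L / 2)) := by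
  have hmpos : (0 : ℝ) < m := by rw [hm]; exact exp_pos L
  have hT' : (NT : ℝ) ^ 2 * ((m : ℝ) + 1) ≤ ((4 : ℝ) ^ m) ^ 2 := by
    have : ((NT ^ 2 * (m + 1) : ℕ) : ℝ) ≤ ((16 ^ m : ℕ) : ℝ) := Nat.cast_le.2 hT
    push_cast at this
    rw [← pow_mul, mul_comm m 2, pow_mul]
    norm_num
    exact this
  have hsq : (NT : ℝ) ^ 2 ≤ ((4 : ℝ) ^ m * exp (-(L / 2))) ^ 2 := by
    rw [mul_pow, ← exp_nat_mul, show ((2 : ℕ) : ℝ) * -(L / 2) = -L by push_cast; ring, exp_neg,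
      ← hm, ← div_eq_mul_inv, le_div_iff₀ hmpos]
    nlinarith [sq_nonneg (NT : ℝ)]
  exact le_of_pow_le_pow_left₀ two_ne_zero (by positivity) hsq

/-- **The final estimate of Case 2**: `½ e^{-L/10} ≤ t · e^{(L/10)(2L+1)} · e^{-e^{L/40}}` with
`L ≥ 4000` forces `t ≥ e^{L²/100}` (indeed `e^{L/40} ≥ (L/40)⁶/720 ≫ L²`).
[cite: Jukna2012, Thm. 9.38, Case 2] -/
theorem pm_case2_final {t : ℕ} {L : ℝ} (hL : 4000 ≤ L)
    (hA : exp (-(L / 10)) / 2 ≤ t * (exp (L / 10 * (2 * L + 1)) * exp (-exp (L / 40)))) :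
    exp (L ^ 2 / 100) ≤ t := by
  have h2e1 : (2 : ℝ) ≤ exp 1 := by linarith [add_one_le_exp (1 : ℝ)]
  have hfin : exp (-(L / 10) - 1 + exp (L / 40) - L / 10 * (2 * L + 1)) ≤ t := by
    have hhalf : exp (-(L / 10) - 1) ≤ exp (-(L / 10)) / 2 := by
      rw [exp_sub]
      exact div_le_div_of_nonneg_left (exp_nonneg _) two_pos h2e1
    have hB := hhalf.trans hA
    have heq : exp (-(L / 10) - 1 + exp (L / 40) - L / 10 * (2 * L + 1)) =
        exp (-(L / 10) - 1) / (exp (L / 10 * (2 * L + 1)) * exp (-exp (L / 40))) := by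
      rw [← exp_add, ← exp_sub]
      ring_nf
    rw [heq, div_le_iff₀ (by positivity)]
    exact hB
  refine le_trans (exp_le_exp.2 ?_) hfin
  -- `L²/100 ≤ e^{L/40} - (L/10)(2L+1) - L/10 - 1`
  have h6 : (L / 40) ^ 6 / ((6 : ℕ).factorial : ℝ) ≤ exp (L / 40) :=
    pow_div_factorial_le_exp (L / 40) (by linarith) 6
  have hfac : ((6 : ℕ).factorial : ℝ) = 720 := by norm_num [Nat.factorial]
  rw [hfac] at h6
  have hy : 100 ≤ L / 40 := by linarith
  have hy4 : (100 : ℝ) ^ 4 ≤ (L / 40) ^ 4 := pow_le_pow_left₀ (by norm_num) hy 4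
  have hy6 : (L / 40) ^ 2 * 100 ^ 4 ≤ (L / 40) ^ 6 := by
    rw [show (L / 40) ^ 6 = (L / 40) ^ 2 * (L / 40) ^ 4 by ring]
    exact mul_le_mul_of_nonneg_left hy4 (sq_nonneg _)
  have hexp : (L / 40) ^ 2 * 100 ^ 4 / 720 ≤ exp (L / 40) :=
    le_trans (div_le_div_of_nonneg_right hy6 (by norm_num)) h6
  have hXL : 100 * (L / 40) ≤ (L / 40) ^ 2 := by
    rw [sq]
    exact mul_le_mul_of_nonneg_right hy (by linarith)
  linarith [hexp, hXL, hy]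

/-- **Case 2 of the proof of Jukna's Thm. 9.38**, with `L = ln m ≥ 4000`, `s ≤ L/10`,
`q ≥ e^{L/8}`: writing `F = 4^m`, the facts `N_F ≤ t · P · D + (F - N_E)` (the dichotomy),
`F ≤ N_F + N_T`, `N_T² (m+1) ≤ 16^m` (Lemma 9.33), `N_E · 2^k = F` with `k ≤ s` (Lemma 9.35),
`P ≤ (m² + 1)^s` (`|Per_s|`) and `D (2ˢ)^q ≤ (2ˢ - 1)^q F` (Lemma 9.37) force `t ≥ e^{L²/100}`:
`2^{-s} - (m+1)^{-1/2} ≤ t (m²+1)^s (1 - 2^{-s})^q ≤ t e^{(L/10)(2L+1)} e^{-e^{L/40}}`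
(Jukna: `t ≥ (2^{-s} - 2m^{-1/2}) (1 - 2^{-s})^{-√r/s} m^{-2s} = m^{Ω(log³ m)}`).
[cite: Jukna2012, Thm. 9.38, Case 2] -/
theorem pm_case2_bound {m s q k t P D NF NT NE : ℕ} {L : ℝ} (hL : 4000 ≤ L) (hm : (m : ℝ) = exp L)
    (hsL : (s : ℝ) ≤ L / 10) (hq : exp (L / 8) ≤ q) (hks : k ≤ s)
    (hP : P ≤ (m * m + 1) ^ s) (hD : D * (2 ^ s) ^ q ≤ (2 ^ s - 1) ^ q * 4 ^ m)
    (hF : 4 ^ m ≤ NF + NT) (hT : NT ^ 2 * (m + 1) ≤ 16 ^ m) (hE : NE * 2 ^ k = 4 ^ m)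
    (h : (NF : ℝ) ≤ t * ((P * D : ℕ) : ℝ) + ((4 ^ m - NE : ℕ) : ℝ)) :
    exp (L ^ 2 / 100) ≤ t := by
  have hL0 : 0 ≤ L := by linarith
  have ht0 : (0 : ℝ) ≤ t := Nat.cast_nonneg t
  have hPD := pm_negErr_real_le hm hL0 hsL hq hP hD
  have hNT := pm_card_true_real_le hm hT
  -- generalize `4^m`
  have hNEle : NE ≤ 4 ^ m := by
    calc NE = NE * 1 := (mul_one _).symm
      _ ≤ NE * 2 ^ k := Nat.mul_le_mul_left _ Nat.one_le_two_pow
      _ = 4 ^ m := hE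
  have hE' : (NE : ℝ) * (2 : ℝ) ^ k = (4 : ℝ) ^ m := by exact_mod_cast hE
  have hb : ((4 ^ m - NE : ℕ) : ℝ) = (4 : ℝ) ^ m - NE := by
    rw [Nat.cast_sub hNEle]
    push_cast
    ring
  have hF' : (4 : ℝ) ^ m ≤ (NF : ℝ) + NT := by exact_mod_cast hF
  rw [hb] at h
  generalize hFdef : (4 : ℝ) ^ m = F at hPD hNT hE' h hF'
  have hFpos : 0 < F := by rw [← hFdef]; positivity
  have h2k : (0 : ℝ) < (2 : ℝ) ^ k := by positivity
  have h2s : (0 : ℝ) < (2 : ℝ) ^ s := by positivity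
  -- (1) `F - NE ≤ F (1 - 2^{-s})`
  have h1 : F - NE ≤ F - F * ((2 : ℝ) ^ s)⁻¹ := by
    have hNE : (NE : ℝ) = F * ((2 : ℝ) ^ k)⁻¹ := by
      rw [← hE', mul_assoc, mul_inv_cancel₀ h2k.ne', mul_one]
    have hks' : ((2 : ℝ) ^ s)⁻¹ ≤ ((2 : ℝ) ^ k)⁻¹ :=
      inv_anti₀ h2k (pow_le_pow_right₀ one_le_two hks)
    have := mul_le_mul_of_nonneg_left hks' hFpos.le
    rw [hNE]
    linarith
  -- (2) combine: `F (2^{-s} - e^{-L/2}) ≤ t P D`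
  have hmain : F * ((2 : ℝ) ^ s)⁻¹ - F * exp (-(L / 2)) ≤
      t * (exp (L / 10 * (2 * L + 1)) * (F * exp (-exp (L / 40)))) := by
    have h' : (NF : ℝ) ≤ t * (exp (L / 10 * (2 * L + 1)) * (F * exp (-exp (L / 40)))) + (F - NE) :=
      h.trans (add_le_add (mul_le_mul_of_nonneg_left hPD ht0) le_rfl)
    linarith
  -- divide by `F`
  have hmain' : ((2 : ℝ) ^ s)⁻¹ - exp (-(L / 2)) ≤
      t * (exp (L / 10 * (2 * L + 1)) * exp (-exp (L / 40))) := by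
    have : F * (((2 : ℝ) ^ s)⁻¹ - exp (-(L / 2))) ≤
        F * (t * (exp (L / 10 * (2 * L + 1)) * exp (-exp (L / 40)))) := by
      calc F * (((2 : ℝ) ^ s)⁻¹ - exp (-(L / 2))) = F * ((2 : ℝ) ^ s)⁻¹ - F * exp (-(L / 2)) := by
            ring
        _ ≤ t * (exp (L / 10 * (2 * L + 1)) * (F * exp (-exp (L / 40)))) := hmain
        _ = F * (t * (exp (L / 10 * (2 * L + 1)) * exp (-exp (L / 40)))) := by ring
    exact le_of_mul_le_mul_left this hFpos
  -- the left-hand side is at least `e^{-L/10} / 2`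
  have h2e1 : (2 : ℝ) ≤ exp 1 := by linarith [add_one_le_exp (1 : ℝ)]
  have hinv_s : exp (-(L / 10)) ≤ ((2 : ℝ) ^ s)⁻¹ := by
    have h2s_le : (2 : ℝ) ^ s ≤ exp (L / 10) := by
      calc (2 : ℝ) ^ s ≤ (exp 1) ^ s := pow_le_pow_left₀ zero_le_two h2e1 s
        _ = exp s := by rw [← exp_nat_mul, mul_one]
        _ ≤ exp (L / 10) := exp_le_exp.2 hsL
    rw [exp_neg]
    exact inv_anti₀ h2s h2s_le
  have hsmall : exp (-(L / 2)) ≤ exp (-(L / 10)) / 2 := by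
    rw [le_div_iff₀ two_pos]
    calc exp (-(L / 2)) * 2 ≤ exp (-(L / 2)) * exp 1 :=
          mul_le_mul_of_nonneg_left h2e1 (exp_nonneg _)
      _ = exp (-(L / 2) + 1) := by rw [exp_add]
      _ ≤ exp (-(L / 10)) := exp_le_exp.2 (by linarith)
  exact pm_case2_final hL (by linarith)

/-! ### Razborov's theorem -/

/-- **Discharge of `Razborov1985b_perfectMatching`** (Razborov 1985b; Jukna 2012, Thm. 9.38:
"Every monotone circuit computing the perfect matching function `f_m` must have `m^{Ω(log m)}`
gates"): with `c = 1/100` (natural logarithm), for all `m ≥ e^{4000}` every circuit over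
`{∧₂, ∨₂}` computing `f_m` has at least `m^{(log m)/100}` gates, and some such circuit exists.
Proof: Razborov's approximation method in the lattice of `r`-closed families of matchings with
`≤ s` edges (`PerfectMatching.razborov_dichotomy`) with `s = ⌊(ln m)/10⌋`, `q = ⌈m^{1/8}⌉`,
`r = (s q)²`, and the estimates `pm_case1_bound`, `pm_case2_bound` (with Lemma 9.33).
[cite: Jukna2012, Thm. 9.38 (PDF pp. 295–296)] [cite: Razborov1985b] [cite: Tardos1988, p. 141 (a)] -/
theorem Razborov1985b_perfectMatching_holds : Razborov1985b_perfectMatching := by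
  classical
  refine ⟨1 / 100, by norm_num, ?_⟩
  rw [eventually_atTop]
  refine ⟨⌈exp 4000⌉₊, fun m hm => ?_⟩
  -- the parameters
  have hm4000 : exp 4000 ≤ (m : ℝ) := (Nat.le_ceil _).trans (by exact_mod_cast hm)
  have hmpos : (0 : ℝ) < m := (exp_pos _).trans_le hm4000
  have hm1 : 1 ≤ m := by
    have : (1 : ℝ) ≤ m := le_trans (by linarith [add_one_le_exp (4000 : ℝ)]) hm4000
    exact_mod_cast this
  set L : ℝ := Real.log m with hL_def
  have hmL : (m : ℝ) = exp L := (exp_log hmpos).symm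
  have hL : 4000 ≤ L := by rwa [hL_def, le_log_iff_exp_le hmpos]
  have hL0 : 0 ≤ L := by linarith
  set s : ℕ := ⌊L / 10⌋₊ with hs_def
  have hsL : (s : ℝ) ≤ L / 10 := Nat.floor_le (by linarith)
  have hLs : L / 10 < s + 1 := Nat.lt_floor_add_one _
  have hs1 : 1 ≤ s := Nat.le_floor (by push_cast; linarith)
  set q : ℕ := ⌈exp (L / 8)⌉₊ with hq_def
  have hq : exp (L / 8) ≤ q := Nat.le_ceil _
  have hq1 : 1 ≤ q := by
    have : (1 : ℝ) ≤ q := le_trans (one_le_exp (by linarith)) hq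
    exact_mod_cast this
  set r : ℕ := (s * q) ^ 2 with hr_def
  have hq2 : 2 ≤ q := Nat.lt_ceil.2 (by rw [Nat.cast_one]; exact one_lt_exp_iff.2 (by linarith))
  have hr2 : 2 ≤ r := by
    have hsq : 2 ≤ s * q := le_trans hq2 (Nat.le_mul_of_pos_left q hs1)
    have h4 : 2 ^ 2 ≤ (s * q) ^ 2 := Nat.pow_le_pow_left hsq 2
    rw [hr_def]
    omega
  -- `ρ = s q ≤ e^{3L/16}`
  have hρ : ((s * q : ℕ) : ℝ) ≤ exp (3 * L / 16) := by
    push_cast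
    have hq' : (q : ℝ) ≤ 2 * exp (L / 8) := by
      have h1 : (q : ℝ) < exp (L / 8) + 1 := Nat.ceil_lt_add_one (exp_nonneg _)
      have h2 : (1 : ℝ) ≤ exp (L / 8) := one_le_exp (by linarith)
      linarith
    have hs' : (s : ℝ) ≤ exp (L / 16) / 2 := by
      have h := sq_le_two_mul_exp (y := L / 16) (by linarith)
      have hLL : 4000 * L ≤ L * L := mul_le_mul_of_nonneg_right hL hL0
      nlinarith [h, hLL, hsL, exp_pos (L / 16)]
    calc (s : ℝ) * q ≤ (exp (L / 16) / 2) * (2 * exp (L / 8)) :=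
          mul_le_mul hs' hq' (Nat.cast_nonneg q) (by positivity)
      _ = exp (3 * L / 16) := by rw [show 3 * L / 16 = L / 16 + L / 8 by ring, exp_add]; ring
  -- a smallest monotone circuit for `f_m`
  obtain ⟨C, hCB, hCf, hsize⟩ := exists_circuit_size_eq_circuitSizeOver
    (exists_monotone_circuit_perfectMatchingFn hm1)
  rw [← hsize]
  have hrpow : (m : ℝ) ^ ((1 : ℝ) / 100 * Real.log m) = exp (L ^ 2 / 100) := by
    rw [rpow_def_of_pos hmpos, ← hL_def]
    ring_nf
  rw [hrpow]
  -- Razborov's dichotomy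
  rcases razborov_dichotomy (q := q) hr2 hs1 (by rw [hr_def]) C hCB hCf
      (fun σ => perfectMatchingFn_permInput σ) with h1 | ⟨E, hE, h2⟩
  · -- Case 1
    have h1' : m.factorial ≤ C.size * ((((s * q) ^ 2 - 1) ^ s) ^ 2 * (m - (s + 1)).factorial) := by
      rw [hr_def] at h1
      exact_mod_cast h1
    exact pm_case1_bound (by linarith) hmL hsL hLs hρ h1'
  · -- Case 2
    have hEm := (mem_Per.1 hE)
    have hNE := card_filter_subset_colorGraph_mul hEm.1
    set NE := #(univ.filter fun h : Vtx m → Bool => E ⊆ colorGraph h) with hNEdef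
    have hcompl : #(univ.filter fun h : Vtx m → Bool => ¬ E ⊆ colorGraph h) = 4 ^ m - NE := by
      have hsum := card_filter_add_card_filter_not (s := (univ : Finset (Vtx m → Bool)))
        (fun h => E ⊆ colorGraph h)
      rw [card_univ, card_colorings] at hsum
      omega
    set NF := #(univ.filter fun h : Vtx m → Bool => perfectMatchingFn m (colorInput h) = false) with hNFdef
    set NT := #(univ.filter fun h : Vtx m → Bool => perfectMatchingFn m (colorInput h) = true) with hNTdef
    have hFT : 4 ^ m ≤ NF + NT := by
      have hsum := card_filter_add_card_filter_not (s := (univ : Finset (Vtx m → Bool)))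
        (fun h => perfectMatchingFn m (colorInput h) = true)
      rw [card_univ, card_colorings] at hsum
      have : (univ.filter fun h : Vtx m → Bool => ¬ perfectMatchingFn m (colorInput h) = true) =
          univ.filter fun h : Vtx m → Bool => perfectMatchingFn m (colorInput h) = false :=
        filter_congr fun h _ => by simp
      rw [this] at hsum
      omega
    rw [hcompl] at h2
    exact pm_case2_bound (P := #(Per m s)) (D := (2 ^ s - 1) ^ q * 4 ^ m / (2 ^ s) ^ q) hL hmL hsL hq
      hEm.2 (card_Per_le s) (Nat.div_mul_le_self _ _) hFT
      (card_filter_perfectMatchingFn_colorInput_sq_mul_le m) hNE h2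

end Literature.Barriers.PneNP

end
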